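import Summits.ResolutionOfSingularities.ResolutionOfSingularities.Theorems.WildASPairLU
import HarnessLib

/-!
# WildASPairLU (2/4) — THE CHART THEOREM for an Artin–Schreier pair: `T⁺ = T[x′, t, (1+σ^i x′_{j_k})⁻¹]`

Node «ASPairCollapse» (decomp-res lens-1 g35), tree file 2/4 (the engine's hypothesis-free chart half).  Frame: a valued
field `(E, O)`; `σ` an automorphism of order dividing `p` preserving `O`; a base `S ⊆ T` with residues in `S`; a `σ`-stable
model `T ⊆ O` whose local ring `B = T_𝔪′` is regular of dimension `d` and universally catenary; a FRAME `x′` of fractions of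
`T` carrying the monomials `x_i = ∏ x′_j^{A i j}` that generate the centre; an ARTIN–SCHREIER PAIR `x′_{j₁}, x′_{j₂} ∈ T`
(`σ x′_j = x′_j (1+x′_{j₁})^{N₁ j}(1+x′_{j₂})^{N₂ j}`, `N₁ j₁ = N₂ j₂ = −1`, `N₂ j₁ = N₁ j₂ = 0`), labelled so that
`v(x′_{j₂}) ≤ v(x′_{j₁})`... no: `v(x′_{j₂}) ≥`— precisely `O.valuation (x′ j₂) ≤ O.valuation (x′ j₁)`, i.e. `t = x′_{j₂}/x′_{j₁} ∈ O`.
THEN the MONOIDAL TRANSFORM `T⁺ := T[x′, t, (1 + σ^i x′_{j₁})⁻¹, (1 + σ^i x′_{j₂})⁻¹ : i < p]` is contained in `O`,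
`σ`-STABLE (`σ t = t(1+x′_{j₁})(1+x′_{j₂})⁻¹`, `σ` permutes the adjoined inverses since `σ^p = 1`), REGULAR of dimension
`d` at the centre of `O` — base change `locAtCentre_closure_locAtCentre_union`, toric chart theorem
`isRegularLocalRing_locAtCentre_adjoin_monomials` and dimension formula `ringKrullDim_locAtCentre_closure_eq` BY NAME, on
the frame `y = x′[j₂ ↦ t]` in which `x_i = ∏ y_j^{A i [j₁ ↦ A i j₁ + A i j₂] j}` (`prod_pow_eq_prod_update_div_pow_update`
by name) — and its centre is generated by `y` when `v(t) < 1`, while in general `𝔪_B ⊆ ∑_{v(y_j)<1} y_j·T[y]`.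
-/

noncomputable section

open IsLocalRing Polynomial Literature.AlgebraicGeometry.Resolution
open Summit.ResolutionOfSingularities.ResolutionOfSingularities.Theorems.InvariantDescentLU
open Summit.ResolutionOfSingularities.ResolutionOfSingularities.Theorems.WildReflectionLU
open Summit.ResolutionOfSingularities.ResolutionOfSingularities.Theorems.WildLogDiagonalLU

universe u

namespace Summit.ResolutionOfSingularities.ResolutionOfSingularities.Theorems.WildASPairLU

variable {E : Type u} [Field E]

/-- The generators adjoined by the AS-PAIR CHART: the frame `x′`, the inverses `(1 + σ^i x′_{j₁})⁻¹`,
`(1 + σ^i x′_{j₂})⁻¹` (`i < p`) and the monoidal coordinate `t = x′_{j₂}/x′_{j₁}`. [folklore] -/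
def chartGens (σ : E ≃+* E) (p : ℕ) {d : ℕ} (x' : Fin d → E) (j₁ j₂ : Fin d) : Set E :=
  Set.range x' ∪ (Set.range (fun i : Fin p => (1 + (σ ^ (i : ℕ)) (x' j₁))⁻¹) ∪
    Set.range (fun i : Fin p => (1 + (σ ^ (i : ℕ)) (x' j₂))⁻¹)) ∪ {x' j₂ / x' j₁}

/-- `chartGens` is a finite set (so that `T[chartGens]` is again a model `ι(R)[t₀⁺]`, `t₀⁺` a finset). [folklore] -/
theorem chartGens_finite (σ : E ≃+* E) (p : ℕ) {d : ℕ} (x' : Fin d → E) (j₁ j₂ : Fin d) :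
    (chartGens σ p x' j₁ j₂).Finite :=
  (((Set.finite_range _).union ((Set.finite_range _).union (Set.finite_range _))).union
    (Set.finite_singleton _))

section Chart

variable (O : ValuationSubring E) {S T : Subring E} {σ : E ≃+* E}
variable (p : ℕ) [hp : Fact p.Prime]

set_option maxHeartbeats 1600000 in
/-- **THE AS-PAIR CHART THEOREM** (hypothesis-free): with the frame of the file header, the monoidal transform
`T⁺ = T[chartGens]` of the Artin–Schreier pair `(x′_{j₁}, x′_{j₂})` (`v(x′_{j₂}) ≤ v(x′_{j₁})`... as valuations:
`O.valuation (x′ j₂) ≤ O.valuation (x′ j₁)`) satisfies: `T⁺ ⊆ O`; `σ T⁺ ⊆ T⁺`; `T⁺_𝔪′` is REGULAR of dimension `d`;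
`T⁺_𝔪′ = (B[y])_𝔪′` for `B = T_𝔪′` and the frame `y = x′[j₂ ↦ t]`; `𝔪_B ⊆ ∑_{v(y_j) < 1} y_j·B[y]`; and if `v(t) < 1`
the frame `y` generates the centre of `T⁺_𝔪′`.  Regularity is the tree's toric chart theorem BY NAME on the monomials
`x_i = ∏ y_j^{A i[j₁ ↦ A i j₁ + A i j₂] j}`. [cite: CossartPiltant2008, proof of Prop. 8.1 (HAL pp. 22–23)]
[cite: KiralyLutkebohmert2013, Thm. 2 (a), pp. 64–66] -/
theorem asChart (hσO : ∀ z : E, z ∈ O ↔ σ z ∈ O) (hσp : σ ^ p = 1)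
    (hST : S ≤ T) (hTO : T ≤ O.toSubring) (hσT : ∀ z ∈ T, σ z ∈ T)
    (hreg : IsRegularLocalRing (locAtCentre T O)) (hTuc : IsUniversallyCatenaryRing (locAtCentre T O))
    (hres : ∀ y ∈ O, ∃ c ∈ S, O.valuation (y - c) < 1)
    {d : ℕ} {x x' : Fin d → E} {A : Fin d → Fin d → ℕ} {j₁ j₂ : Fin d} {N₁ N₂ : Fin d → ℤ}
    (hdim : ringKrullDim (locAtCentre T O) = d)
    (hx : ∀ i, x i ∈ locAtCentre T O ∧ O.valuation (x i) < 1)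
    (hgen : ∀ b ∈ locAtCentre T O, O.valuation b < 1 →
      ∃ c : Fin d → E, (∀ i, c i ∈ locAtCentre T O) ∧ b = ∑ i, c i * x i)
    (hx' : ∀ j, x' j ≠ 0 ∧ x' j ∈ O ∧ O.valuation (x' j) < 1 ∧ ∃ a b : E, a ∈ T ∧ b ∈ T ∧ x' j = a / b)
    (hmon : ∀ i, x i = ∏ j, x' j ^ A i j)
    (hj : j₁ ≠ j₂) (hx'T : x' j₁ ∈ T ∧ x' j₂ ∈ T)
    (hN : N₁ j₁ = -1 ∧ N₂ j₁ = 0 ∧ N₁ j₂ = 0 ∧ N₂ j₂ = -1)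
    (htw : ∀ j, σ (x' j) = x' j * (1 + x' j₁) ^ N₁ j * (1 + x' j₂) ^ N₂ j)
    (hle : O.valuation (x' j₂) ≤ O.valuation (x' j₁))
    (T' : Subring E) (hT' : T' = Subring.closure ((T : Set E) ∪ chartGens σ p x' j₁ j₂)) :
    T' ≤ O.toSubring ∧ (∀ z ∈ T', σ z ∈ T') ∧ IsRegularLocalRing (locAtCentre T' O) ∧
      ringKrullDim (locAtCentre T' O) = d ∧
      locAtCentre T' O = locAtCentre (Subring.closure ((locAtCentre T O : Set E) ∪
        Set.range (Function.update x' j₂ (x' j₂ / x' j₁)))) O ∧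
      (∀ a ∈ locAtCentre T O, O.valuation a < 1 → ∃ r : Fin d → E,
        (∀ j, r j ∈ Subring.closure ((locAtCentre T O : Set E) ∪
          Set.range (Function.update x' j₂ (x' j₂ / x' j₁)))) ∧
        (∀ j, O.valuation (Function.update x' j₂ (x' j₂ / x' j₁) j) = 1 → r j = 0) ∧
        a = ∑ j, r j * Function.update x' j₂ (x' j₂ / x' j₁) j) ∧
      (O.valuation (x' j₂ / x' j₁) < 1 → ∀ b ∈ locAtCentre T' O, O.valuation b < 1 →
        ∃ c : Fin d → E, (∀ j, c j ∈ locAtCentre T' O) ∧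
          b = ∑ j, c j * Function.update x' j₂ (x' j₂ / x' j₁) j) := by
  classical
  subst hT'
  obtain ⟨hN₁₁, hN₂₁, hN₁₂, hN₂₂⟩ := hN
  set t : E := x' j₂ / x' j₁ with htdef
  set z₁ : Fin p → E := fun i => (1 + (σ ^ (i : ℕ)) (x' j₁))⁻¹ with hz₁def
  set z₂ : Fin p → E := fun i => (1 + (σ ^ (i : ℕ)) (x' j₂))⁻¹ with hz₂def
  have hgens : chartGens σ p x' j₁ j₂ = Set.range x' ∪ (Set.range z₁ ∪ Set.range z₂) ∪ {t} := rfl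
  rw [hgens]
  set T' : Subring E := Subring.closure ((T : Set E) ∪ (Set.range x' ∪ (Set.range z₁ ∪ Set.range z₂) ∪ {t}))
    with hT'def
  set y : Fin d → E := Function.update x' j₂ t with hydef
  set B : Subring E := locAtCentre T O with hBdef
  haveI : IsLocalRing B := isLocalRing_locAtCentre hTO
  haveI := hreg
  haveI : IsNoetherianRing B := inferInstance
  have hBO : B ≤ O.toSubring := locAtCentre_le hTO
  have hTB : T ≤ B := le_locAtCentre T O
  have hmem : ∀ b : B, b ∈ maximalIdeal B ↔ O.valuation (b : E) < 1 := mem_maximalIdeal_locAtCentre_iff hTO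
  have hx0 : ∀ j, x' j ≠ 0 := fun j => (hx' j).1
  have htO : t ∈ O := by
    rw [← O.valuation_le_one_iff, htdef, map_div₀]
    exact div_le_one_of_le₀ hle zero_le
  have hx2 : x' j₂ = t * x' j₁ := by rw [htdef, div_mul_cancel₀ _ (hx0 j₁)]
  have hyj₂ : y j₂ = t := Function.update_self j₂ t x'
  have hyne : ∀ j, j ≠ j₂ → y j = x' j := fun j h => Function.update_of_ne h t x'
  have hyj₁ : y j₁ = x' j₁ := hyne j₁ hj
  have hyO : ∀ j, y j ∈ O := fun j => by
    by_cases hj2 : j = j₂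
    · rw [hj2, hyj₂]; exact htO
    · rw [hyne j hj2]; exact (hx' j).2.1
  -- iterates of `σ`, the inverses `z_k i ∈ B`
  have hσiO : ∀ (i : ℕ) (b : E), b ∈ O ↔ (σ ^ i) b ∈ O := mem_iff_pow_apply_mem O hσO
  have hσiT : ∀ (i : ℕ) {b : E}, b ∈ T → (σ ^ i) b ∈ T := fun i b hb => pow_apply_mem_of_stable hσT i hb
  have h1i : ∀ (i : ℕ) (j : Fin d), O.valuation (1 + (σ ^ i) (x' j)) = 1 := fun i j =>
    valuation_one_add_eq_one O (valuation_apply_lt_one O (hσiO i) (hx' j).2.2.1)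
  have hU0 : ∀ j, (1 + x' j) ≠ 0 := fun j => by
    have h := h1i 0 j
    rw [pow_zero, RingAut.one_apply] at h
    exact ne_zero_of_valuation_eq_one h
  have hz₁B : ∀ i, z₁ i ∈ B := fun i =>
    inv_mem_locAtCentre (hTB (T.add_mem T.one_mem (hσiT i hx'T.1))) (h1i i j₁)
  have hz₂B : ∀ i, z₂ i ∈ B := fun i =>
    inv_mem_locAtCentre (hTB (T.add_mem T.one_mem (hσiT i hx'T.2))) (h1i i j₂)
  -- `T′` basics
  have hTT' : T ≤ T' := fun b hb => Subring.subset_closure (Or.inl hb)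
  have hx'T' : ∀ j, x' j ∈ T' := fun j => Subring.subset_closure (Or.inr (Or.inl (Or.inl ⟨j, rfl⟩)))
  have hz₁T' : ∀ i, z₁ i ∈ T' := fun i => Subring.subset_closure (Or.inr (Or.inl (Or.inr (Or.inl ⟨i, rfl⟩))))
  have hz₂T' : ∀ i, z₂ i ∈ T' := fun i => Subring.subset_closure (Or.inr (Or.inl (Or.inr (Or.inr ⟨i, rfl⟩))))
  have htT' : t ∈ T' := Subring.subset_closure (Or.inr (Or.inr rfl))
  have hT'O : T' ≤ O.toSubring := Subring.closure_le.mpr (by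
    rintro b (hb | ((⟨j, rfl⟩ | (⟨i, rfl⟩ | ⟨i, rfl⟩)) | hb))
    · exact hTO hb
    · exact (hx' j).2.1
    · exact hBO (hz₁B i)
    · exact hBO (hz₂B i)
    · rw [Set.mem_singleton_iff.mp hb]; exact htO)
  have h1T' : ∀ j, 1 + x' j ∈ T' := fun j => T'.add_mem T'.one_mem (hx'T' j)
  have hinv₁T' : (1 + x' j₁)⁻¹ ∈ T' := by
    have h := hz₁T' ⟨0, hp.out.pos⟩
    simp only [hz₁def, pow_zero, RingAut.one_apply] at h
    exact h
  have hinv₂T' : (1 + x' j₂)⁻¹ ∈ T' := by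
    have h := hz₂T' ⟨0, hp.out.pos⟩
    simp only [hz₂def, pow_zero, RingAut.one_apply] at h
    exact h
  have hzpow₁ : ∀ n : ℤ, (1 + x' j₁) ^ n ∈ T' := zpow_mem_of_inv_mem T' (h1T' j₁) hinv₁T'
  have hzpow₂ : ∀ n : ℤ, (1 + x' j₂) ^ n ∈ T' := zpow_mem_of_inv_mem T' (h1T' j₂) hinv₂T'
  -- (1) `σ`-STABILITY: `σ x′_j ∈ x′_j·U^ℤ`, `σ` permutes the `z_k i` (`σ^p = 1`), `σ t = t(1+x′_{j₁})(1+x′_{j₂})⁻¹`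
  have hσz : ∀ (η : E) (i : Fin p), ∃ i' : Fin p,
      σ ((1 + (σ ^ (i : ℕ)) η)⁻¹) = (1 + (σ ^ (i' : ℕ)) η)⁻¹ := by
    intro η i
    refine ⟨⟨((i : ℕ) + 1) % p, Nat.mod_lt _ hp.out.pos⟩, ?_⟩
    have e : σ ^ ((i : ℕ) + 1) = σ ^ (((i : ℕ) + 1) % p) := by
      conv_lhs => rw [← Nat.mod_add_div ((i : ℕ) + 1) p, pow_add, pow_mul, hσp, one_pow, mul_one]
    rw [map_inv₀, map_add, map_one, ← RingAut.mul_apply, ← pow_succ', e]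
  have hσt : σ t = t * (1 + x' j₁) * (1 + x' j₂)⁻¹ := by
    have h0 := hx0 j₁
    have h1 := hU0 j₁
    have h2 := hU0 j₂
    rw [htdef, map_div₀, htw j₁, htw j₂, hN₁₁, hN₂₁, hN₁₂, hN₂₂]
    simp only [zpow_zero, mul_one, zpow_neg, zpow_one]
    field_simp
  have hσT' : ∀ b ∈ T', σ b ∈ T' := by
    intro b hb
    induction hb using Subring.closure_induction with
    | mem b hb =>
        rcases hb with hb | ((⟨j, rfl⟩ | (⟨i, rfl⟩ | ⟨i, rfl⟩)) | hb)
        · exact hTT' (hσT b hb)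
        · rw [htw j]
          exact T'.mul_mem (T'.mul_mem (hx'T' j) (hzpow₁ (N₁ j))) (hzpow₂ (N₂ j))
        · obtain ⟨i', e⟩ := hσz (x' j₁) i
          rw [e]
          exact hz₁T' i'
        · obtain ⟨i', e⟩ := hσz (x' j₂) i
          rw [e]
          exact hz₂T' i'
        · rw [Set.mem_singleton_iff.mp hb, hσt]
          exact T'.mul_mem (T'.mul_mem htT' (h1T' j₁)) hinv₂T'
    | zero => rw [map_zero]; exact T'.zero_mem
    | one => rw [map_one]; exact T'.one_mem
    | add a b _ _ ha hb => rw [map_add]; exact T'.add_mem ha hb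
    | neg a _ ha => rw [map_neg]; exact T'.neg_mem ha
    | mul a b _ _ ha hb => rw [map_mul]; exact T'.mul_mem ha hb
  -- (2) REGULARITY: base change to `B`, the frame `y = x′[j₂ ↦ t]`, toric chart theorem by name
  have hE2 : Subring.closure ((B : Set E) ∪ (Set.range x' ∪ (Set.range z₁ ∪ Set.range z₂) ∪ {t})) =
      Subring.closure ((B : Set E) ∪ Set.range y) := by
    refine le_antisymm (Subring.closure_le.mpr ?_) (Subring.closure_le.mpr ?_)
    · rintro b (hb | ((⟨j, rfl⟩ | (⟨i, rfl⟩ | ⟨i, rfl⟩)) | hb))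
      · exact Subring.subset_closure (Or.inl hb)
      · by_cases hj2 : j = j₂
        · rw [hj2, hx2]
          exact Subring.mul_mem _ (Subring.subset_closure (Or.inr ⟨j₂, hyj₂⟩))
            (Subring.subset_closure (Or.inr ⟨j₁, hyj₁⟩))
        · exact Subring.subset_closure (Or.inr ⟨j, hyne j hj2⟩)
      · exact Subring.subset_closure (Or.inl (hz₁B i))
      · exact Subring.subset_closure (Or.inl (hz₂B i))
      · rw [Set.mem_singleton_iff.mp hb]
        exact Subring.subset_closure (Or.inr ⟨j₂, hyj₂⟩)
    · rintro b (hb | ⟨j, rfl⟩)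
      · exact Subring.subset_closure (Or.inl hb)
      · by_cases hj2 : j = j₂
        · rw [hj2, hyj₂]
          exact Subring.subset_closure (Or.inr (Or.inr rfl))
        · rw [hyne j hj2]
          exact Subring.subset_closure (Or.inr (Or.inl (Or.inl ⟨j, rfl⟩)))
  have hE1 : locAtCentre T' O = locAtCentre (Subring.closure ((B : Set E) ∪ Set.range y)) O := by
    rw [← hE2, hBdef, locAtCentre_closure_locAtCentre_union]
  let G : Set B := Set.range fun i => (⟨x i, (hx i).1⟩ : B)
  have hcoe : ∀ g : Fin d → B, (((∑ i, g i : B)) : E) = ∑ i, (g i : E) := fun g =>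
    map_sum B.subtype g Finset.univ
  have hG : Ideal.span G = maximalIdeal B := by
    refine le_antisymm (Ideal.span_le.mpr ?_) fun a ha => ?_
    · rintro _ ⟨i, rfl⟩
      exact (hmem _).mpr (hx i).2
    · obtain ⟨c, hc, hsum⟩ := hgen a a.2 ((hmem a).mp ha)
      have e : a = ∑ i, (⟨c i, hc i⟩ : B) * ⟨x i, (hx i).1⟩ := by
        apply Subtype.ext
        rw [hcoe]
        exact hsum
      rw [e]
      exact Ideal.sum_mem _ fun i _ => Ideal.mul_mem_left _ _ (Ideal.subset_span ⟨i, rfl⟩)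
  have hGmon : ∀ g ∈ G, ∃ c : Fin d → ℕ, ((g : B) : E) = ∏ j, y j ^ c j := by
    rintro _ ⟨i, rfl⟩
    refine ⟨Function.update (A i) j₁ (A i j₁ + A i j₂), ?_⟩
    show x i = _
    rw [hmon i, hydef, htdef]
    exact prod_pow_eq_prod_update_div_pow_update x' (A i) hj (hx0 j₁)
  set Yf : Finset E := Finset.univ.image y with hYf
  have hYcoe : (Yf : Set E) = Set.range y := by simp [hYf]
  have hb : ∀ w ∈ Yf, ∃ a e : B, (e : E) ≠ 0 ∧ w = a / e := by
    intro w hw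
    obtain ⟨j, -, rfl⟩ := Finset.mem_image.mp hw
    by_cases hj2 : j = j₂
    · obtain ⟨hx20, -, -, a, b, ha, hb, hab⟩ := hx' j₂
      refine ⟨⟨a, hTB ha⟩, ⟨b * x' j₁, hTB (T.mul_mem hb hx'T.1)⟩, ?_, ?_⟩
      · show (b * x' j₁ : E) ≠ 0
        exact mul_ne_zero (fun hb0 => hx20 (by rw [hab, hb0, div_zero])) (hx0 j₁)
      · rw [hj2, hyj₂]
        show t = a / (b * x' j₁)
        rw [htdef, hab, div_div]
    · obtain ⟨hxj0, -, -, a, b, ha, hb, hab⟩ := hx' j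
      refine ⟨⟨a, hTB ha⟩, ⟨b, hTB hb⟩, fun hb0 => hxj0 ?_, by rw [hyne j hj2]; exact hab⟩
      have hb0' : b = 0 := hb0
      rw [hab, hb0', div_zero]
  have hXO : Subring.closure ((B : Set E) ∪ (Yf : Set E)) ≤ O.toSubring := by
    rw [hYcoe]
    exact Subring.closure_le.mpr (Set.union_subset hBO (by rintro _ ⟨j, rfl⟩; exact hyO j))
  have hdomB : ∀ r : B, r ∈ maximalIdeal B → O.valuation (r : E) < 1 := fun r hr => (hmem r).mp hr
  have h1nm : (1 : B) ∉ maximalIdeal B := fun h => by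
    have h' := (hmem 1).mp h
    rw [OneMemClass.coe_one, map_one] at h'
    exact lt_irrefl _ h'
  have halg : ∀ w : O, ∃ q : Polynomial B, (∃ i, q.coeff i ∉ maximalIdeal B) ∧
      O.valuation (Polynomial.aeval (w : E) q) < 1 := by
    intro w
    obtain ⟨c, hcS, hvc⟩ := hres w w.2
    refine ⟨X - C (⟨c, hTB (hST hcS)⟩ : B), ⟨1, ?_⟩, ?_⟩
    · rw [coeff_sub, coeff_X_one, coeff_C, if_neg one_ne_zero, sub_zero]
      exact h1nm
    · have e : Polynomial.aeval (w : E) (X - C (⟨c, hTB (hST hcS)⟩ : B)) = w - c := by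
        rw [map_sub, aeval_X, aeval_C]
        rfl
      rw [e]
      exact hvc
  have hdim' : ringKrullDim (locAtCentre (Subring.closure ((B : Set E) ∪ Set.range y)) O) = d := by
    have h := ringKrullDim_locAtCentre_closure_eq O hTuc hBO hdomB halg Yf hb hXO
    rw [hYcoe] at h
    rw [h, hBdef, hdim]
  have hregX : IsRegularLocalRing (locAtCentre (Subring.closure ((B : Set E) ∪ Set.range y)) O) :=
    isRegularLocalRing_locAtCentre_adjoin_monomials O B hBO hmem y hyO G hG hGmon hdim'
  -- (3) GENERATION: `𝔪_B ⊆ ∑_{v(y_j)<1} y_j B[y]`; if `v(t) < 1` the frame `y` generates the new centre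
  have hmB : ∀ a ∈ B, O.valuation a < 1 → ∃ r : Fin d → E,
      (∀ j, r j ∈ Subring.closure ((B : Set E) ∪ Set.range y)) ∧ (∀ j, O.valuation (y j) = 1 → r j = 0) ∧
      a = ∑ j, r j * y j := fun a ha hav =>
    exists_sum_mul_pos_of_mem_maximalIdeal O B hmem y hyO G hG hGmon ((hmem ⟨a, ha⟩).mpr hav)
  refine ⟨hT'O, hσT', by rw [hE1]; exact hregX, by rw [hE1]; exact hdim', hE1, hmB, fun hvt b hb hbv => ?_⟩
  have hypos : ∀ j, O.valuation (y j) < 1 := fun j => by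
    by_cases hj2 : j = j₂
    · rw [hj2, hyj₂]; exact hvt
    · rw [hyne j hj2]; exact (hx' j).2.2.1
  rw [hE1] at hb ⊢
  exact exists_sum_mul_of_mem_maximalIdeal_locAtCentre_of_forall_lt O B hBO hmem y hyO hypos G hG hGmon hb hbv

end Chart

end Summit.ResolutionOfSingularities.ResolutionOfSingularities.Theorems.WildASPairLU

end
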